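import Literature.NumberTheory.NumberFields.EisensteinFieldSelmer
import Literature.NumberTheory.NumberFields.EisensteinFieldPrimes
import HarnessLib

/-!
# `K(S, 3)` of `ℚ(ζ₃)` for `S = {λ, 2, p, q}`, `p, q` odd inert primes: normal forms `±ζ^i λ^j 2^k p^l q^m w³`

Topic `NumberTheory/NumberFields`. Parametric version of `EisensteinFieldSelmer330.lean` (the case `p = 5`, `q = 11`):
for two distinct rational primes `p, q ≡ 2 (mod 3)`, `p, q ≠ 2` — inert in `𝓞 K3 = ℤ[ζ₃]` (Ireland–Rosen 9.1.4) — the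
finite group generated by the descent values of the `√−3`-descent on `y² = x³ + (pq)²` (Jeong 2019, §3: the family
`A_{pq}`; Cohen–Pazuki 2009) is made explicit:

* `K3.associated_of_prime_of_dvd_six_mul`: a prime element dividing `6pq` is associated to `λ`, `2`, `p` or `q`;
* `K3.exists_normal_form_twoInert`: if `3 ∣ ord_v(b)` for all finite places `v ∌ 6pq`, then
  `b = s ζ^i (ζ − 1)^j 2^k p^l q^m w³` with `s = ±1`, `i, j, k, l, m < 3`, `w ≠ 0`;
* valuations of such a normal form at `λ`, `2`, `p`, `q` and the extraction lemmas (`j/k/l/m_eq_zero_of_dvd_twoInert`);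
* for `j = 0`: `χ₂ = i` (`chi2_normalForm_twoInert`); the class modulo cubes
  (`cubeClass_normalForm_twoInert(_of_i_j_eq_zero)`).

## References

* J. H. Silverman, *The Arithmetic of Elliptic Curves*, 2nd ed., GTM 106 (2009), Prop. VIII.1.6, Prop. X.4.9.
  [SilvermanAEC2009]
* K. Ireland, M. Rosen, *A Classical Introduction to Modern Number Theory*, 2nd ed., GTM 84 (1990), Prop. 9.1.4,
  Ch. 9 §3. [IrelandRosen1990]
* K. Jeong, *Infinitely many elliptic curves of rank exactly two II*, Proc. Japan Acad. 95 (2019), §3.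
  [Jeong2019RankExactlyTwoII]
-/

noncomputable section

open QuadraticAlgebra NumberField IsDedekindDomain IsDedekindDomain.HeightOneSpectrum
open WithZero (log exp)
open scoped WithZero
open Literature.NumberTheory.EllipticCurves.MordellDescent (cubeClass CubeUnits cubeClass_mul
  cubeClass_neg cubeClass_mul_pow_three cubeClass_eq_cubeClass_iff)

namespace Literature.NumberTheory.NumberFields

namespace K3

section TwoInert

variable {p q : ℕ} [hpp : Fact p.Prime] [hqp : Fact q.Prime]
  (hp3 : p % 3 = 2) (hq3 : q % 3 = 2) (hp2 : p ≠ 2) (hq2 : q ≠ 2) (hpq : p ≠ q)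

/-- An inert prime `p ≡ 2 (mod 3)` is prime in `𝓞 K3` (cast from `ℕ`). [cite: IrelandRosen1990, Prop. 9.1.4] -/
theorem prime_natCast_of_inert (p : ℕ) [hpp : Fact p.Prime] (hp3 : p % 3 = 2) : Prime ((p : ℕ) : 𝓞 K3) := by
  have h := prime_natCast_of_mod_three_eq_two hpp.out hp3
  simpa using h

omit hpp in
/-- `p ∤ 3` for `p ≡ 2 (mod 3)`, i.e. `3 ∤ p`. [folklore] -/
private theorem not_three_dvd (hp3 : p % 3 = 2) : ¬ 3 ∣ p := by omega

/-- **A prime element of `𝓞 K3` dividing `6` is associated to `λ` or `2`** (`6 = 2 · (−ζ²λ²)`).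
[cite: IrelandRosen1990, Prop. 9.1.4] -/
theorem associated_of_prime_of_dvd_six {r : 𝓞 K3} (hr : Prime r) (h : r ∣ 6) :
    Associated r lamInt ∨ Associated r 2 := by
  have h6 : (6 : 𝓞 K3) = 2 * -(zetaInt ^ 2 * lamInt ^ 2) := by
    rw [← three_eq_neg_zetaInt_sq_mul_lamInt_sq]; norm_num
  rw [h6] at h
  rcases hr.dvd_or_dvd h with h2 | h3
  · exact Or.inr (hr.irreducible.associated_of_dvd prime_two.irreducible h2)
  · rw [dvd_neg] at h3
    rcases hr.dvd_or_dvd h3 with hz | hl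
    · exfalso
      have hu : IsUnit (zetaInt ^ 2) :=
        (isPrimitiveRoot_zeta.toInteger_isPrimitiveRoot.isUnit (by norm_num)).pow 2
      exact hr.not_unit (isUnit_of_dvd_unit hz hu)
    · exact Or.inl (hr.irreducible.associated_of_dvd prime_lamInt.irreducible (hr.dvd_of_dvd_pow hl))

include hp3 hq3 in
/-- **A prime element dividing `6pq` is associated to `λ`, `2`, `p` or `q`** (`p, q` inert).
[cite: IrelandRosen1990, Prop. 9.1.4] -/
theorem associated_of_prime_of_dvd_six_mul {r : 𝓞 K3} (hr : Prime r) (h : r ∣ 6 * p * q) :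
    Associated r lamInt ∨ Associated r 2 ∨ Associated r (p : 𝓞 K3) ∨ Associated r (q : 𝓞 K3) := by
  rcases hr.dvd_or_dvd h with h6p | hq
  · rcases hr.dvd_or_dvd h6p with h6 | hp
    · rcases associated_of_prime_of_dvd_six hr h6 with h | h
      · exact Or.inl h
      · exact Or.inr (Or.inl h)
    · exact Or.inr (Or.inr (Or.inl (hr.irreducible.associated_of_dvd (prime_natCast_of_inert p hp3).irreducible hp)))
  · exact Or.inr (Or.inr (Or.inr (hr.irreducible.associated_of_dvd (prime_natCast_of_inert q hq3).irreducible hq)))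

include hp3 hq3 in
/-- Every prime element dividing `6pq` is associated to one of `λ, 2, p, q` (generator form). [folklore] -/
private theorem gens_spec_twoInert (r : 𝓞 K3) (hr : Prime r) (h : r ∣ 6 * p * q) :
    ∃ i, Associated r ((![lamInt, 2, (p : 𝓞 K3), (q : 𝓞 K3)] : Fin 4 → 𝓞 K3) i) := by
  rcases associated_of_prime_of_dvd_six_mul hp3 hq3 hr h with h | h | h | h
  · exact ⟨0, h⟩
  · exact ⟨1, h⟩
  · exact ⟨2, h⟩
  · exact ⟨3, h⟩

include hp3 hq3 in
/-- **Normal form of `K(S, 3)`, `S = {λ, 2, p, q}`** (`p, q` inert): if `b ∈ K3ˣ` has `3 ∣ ord_v(b)` for every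
finite place `v ∌ 6pq`, then `b = s ζ^i (ζ − 1)^j 2^k p^l q^m w³` with `s = ±1`, `i, j, k, l, m < 3`, `w ≠ 0`.
[cite: SilvermanAEC2009, Prop. VIII.1.6 (proof)] -/
theorem exists_normal_form_twoInert {b : K3} (hb : b ≠ 0)
    (hval : ∀ v : HeightOneSpectrum (𝓞 K3), (6 * p * q : 𝓞 K3) ∉ v.asIdeal →
      (3 : ℤ) ∣ log (v.valuation K3 b)) :
    ∃ (s : ℤ) (i j k l m : ℕ) (w : K3), (s = 1 ∨ s = -1) ∧ i < 3 ∧ j < 3 ∧ k < 3 ∧ l < 3 ∧ m < 3 ∧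
      w ≠ 0 ∧ b = s * zeta ^ i * (zeta - 1) ^ j * 2 ^ k * (p : K3) ^ l * (q : K3) ^ m * w ^ 3 := by
  obtain ⟨u, e, w, he, hw, h⟩ := exists_eq_unit_mul_prod_pow_mul_pow (K := K3) (6 * p * q)
    (![lamInt, 2, (p : 𝓞 K3), (q : 𝓞 K3)] : Fin 4 → 𝓞 K3) (gens_spec_twoInert hp3 hq3) (n := 3) (by norm_num) hb hval
  obtain ⟨s, i, hs, hi, hu⟩ := exists_coe_unit_eq u
  refine ⟨s, i, e 0, e 1, e 2, e 3, w, hs, hi, he 0, he 1, he 2, he 3, hw, ?_⟩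
  rw [h, Fin.prod_univ_four, hu]
  simp only [Matrix.cons_val_zero, Matrix.cons_val_one, Matrix.cons_val, coe_lamInt, algebraMap_two]
  rw [coe_natCast_ringOfIntegers, coe_natCast_ringOfIntegers]
  ring

/-! ### Valuations of a normal form -/

section Valuations

variable {s : ℤ} (hs : s = 1 ∨ s = -1) (i j k l m : ℕ) {w : K3} (hw : w ≠ 0)
include hs hw

/-- A normal form is non-zero. [cite: SilvermanAEC2009, Prop. X.4.9] -/
theorem normalForm_twoInert_ne_zero :
    (s : K3) * zeta ^ i * (zeta - 1) ^ j * 2 ^ k * (p : K3) ^ l * (q : K3) ^ m * w ^ 3 ≠ 0 := by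
  have hs0 : (s : K3) ≠ 0 := by rcases hs with rfl | rfl <;> norm_num
  have hz : (zeta : K3) ≠ 0 := isPrimitiveRoot_zeta.ne_zero (by norm_num)
  exact mul_ne_zero (mul_ne_zero (mul_ne_zero (mul_ne_zero (mul_ne_zero (mul_ne_zero hs0
    (pow_ne_zero _ hz)) (pow_ne_zero _ zeta_sub_one_ne_zero)) (pow_ne_zero _ two_ne_zero))
    (pow_ne_zero _ (natCast_ne_zero (p := p)))) (pow_ne_zero _ (natCast_ne_zero (p := q)))) (pow_ne_zero _ hw)

/-- Generic valuation of a normal form at a prime element `r` (additivity of `ord_r`). [cite: SilvermanAEC2009, Prop. X.4.9] -/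
theorem log_val_normalForm_twoInert {r : 𝓞 K3} (hr : Prime r) :
    log (val hr ((s : K3) * zeta ^ i * (zeta - 1) ^ j * 2 ^ k * (p : K3) ^ l * (q : K3) ^ m * w ^ 3)) =
      j * log (val hr (zeta - 1)) + k * log (val hr 2) + l * log (val hr (p : K3)) + m * log (val hr (q : K3)) +
        3 * log (val hr w) := by
  have hs0 : (s : K3) ≠ 0 := by rcases hs with rfl | rfl <;> norm_num
  have hz : (zeta : K3) ≠ 0 := isPrimitiveRoot_zeta.ne_zero (by norm_num)
  have hp0 : (p : K3) ≠ 0 := natCast_ne_zero (p := p)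
  have hq0 : (q : K3) ≠ 0 := natCast_ne_zero (p := q)
  have h1 : (s : K3) * zeta ^ i ≠ 0 := mul_ne_zero hs0 (pow_ne_zero _ hz)
  have h2 : (s : K3) * zeta ^ i * (zeta - 1) ^ j ≠ 0 := mul_ne_zero h1 (pow_ne_zero _ zeta_sub_one_ne_zero)
  have h3 : (s : K3) * zeta ^ i * (zeta - 1) ^ j * 2 ^ k ≠ 0 := mul_ne_zero h2 (pow_ne_zero _ two_ne_zero)
  have h4 : (s : K3) * zeta ^ i * (zeta - 1) ^ j * 2 ^ k * (p : K3) ^ l ≠ 0 := mul_ne_zero h3 (pow_ne_zero _ hp0)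
  have h5 : (s : K3) * zeta ^ i * (zeta - 1) ^ j * 2 ^ k * (p : K3) ^ l * (q : K3) ^ m ≠ 0 :=
    mul_ne_zero h4 (pow_ne_zero _ hq0)
  rw [Valuation.log_map_mul _ h5 (pow_ne_zero _ hw), Valuation.log_map_mul _ h4 (pow_ne_zero _ hq0),
    Valuation.log_map_mul _ h3 (pow_ne_zero _ hp0), Valuation.log_map_mul _ h2 (pow_ne_zero _ two_ne_zero),
    Valuation.log_map_mul _ h1 (pow_ne_zero _ zeta_sub_one_ne_zero), Valuation.log_map_mul _ hs0 (pow_ne_zero _ hz),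
    Valuation.log_map_pow, Valuation.log_map_pow, Valuation.log_map_pow, Valuation.log_map_pow,
    Valuation.log_map_pow, Valuation.log_map_pow, log_val_sign hr hs, log_val_zeta hr]
  ring

include hp3 hq3 in
/-- **At `λ`**: `log vL = −j + 3 log vL(w)` (`p, q` prime to `3`). [cite: SilvermanAEC2009, Prop. X.4.9] -/
theorem log_vL_normalForm_twoInert :
    log (vL ((s : K3) * zeta ^ i * (zeta - 1) ^ j * 2 ^ k * (p : K3) ^ l * (q : K3) ^ m * w ^ 3)) =
      -j + 3 * log (vL w) := by
  rw [vL, log_val_normalForm_twoInert hs i j k l m hw prime_lamInt, ← coe_lamInt, log_val_self,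
    show (2 : K3) = ((2 : ℕ) : K3) by norm_num, log_val_lam_natCast (by norm_num),
    log_val_lam_natCast (not_three_dvd hp3), log_val_lam_natCast (not_three_dvd hq3)]
  ring

include hp2 hq2 in
/-- **At `2`**: `log val₂ = −k + 3 log val₂(w)` (`p, q` odd). [cite: SilvermanAEC2009, Prop. X.4.9] -/
theorem log_val2_normalForm_twoInert :
    log (val prime_natCast_two ((s : K3) * zeta ^ i * (zeta - 1) ^ j * 2 ^ k * (p : K3) ^ l * (q : K3) ^ m * w ^ 3)) =
      -k + 3 * log (val prime_natCast_two w) := by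
  have hp' : ¬ 2 ∣ p := fun h => hp2 ((Nat.prime_dvd_prime_iff_eq Nat.prime_two hpp.out).mp h).symm
  have hq' : ¬ 2 ∣ q := fun h => hq2 ((Nat.prime_dvd_prime_iff_eq Nat.prime_two hqp.out).mp h).symm
  rw [log_val_normalForm_twoInert hs i j k l m hw prime_natCast_two, log_val_zeta_sub_one,
    show (2 : K3) = ((2 : ℕ) : K3) by norm_num, log_val_natCast_self,
    log_val_natCast_of_not_dvd _ hp', log_val_natCast_of_not_dvd _ hq']
  ring

include hp3 hp2 hpq in
/-- **At `p`**: `log val_p = −l + 3 log val_p(w)`. [cite: SilvermanAEC2009, Prop. X.4.9] -/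
theorem log_valp_normalForm_twoInert :
    log (val (prime_natCast_of_inert p hp3)
        ((s : K3) * zeta ^ i * (zeta - 1) ^ j * 2 ^ k * (p : K3) ^ l * (q : K3) ^ m * w ^ 3)) =
      -l + 3 * log (val (prime_natCast_of_inert p hp3) w) := by
  have h2' : ¬ p ∣ 2 := fun h => hp2 ((Nat.prime_dvd_prime_iff_eq hpp.out Nat.prime_two).mp h)
  have hq' : ¬ p ∣ q := fun h => hpq ((Nat.prime_dvd_prime_iff_eq hpp.out hqp.out).mp h)
  rw [log_val_normalForm_twoInert hs i j k l m hw (prime_natCast_of_inert p hp3), log_val_zeta_sub_one,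
    show (2 : K3) = ((2 : ℕ) : K3) by norm_num, log_val_natCast_of_not_dvd _ h2', log_val_natCast_self,
    log_val_natCast_of_not_dvd _ hq']
  ring

include hq3 hq2 hpq in
/-- **At `q`**: `log val_q = −m + 3 log val_q(w)`. [cite: SilvermanAEC2009, Prop. X.4.9] -/
theorem log_valq_normalForm_twoInert :
    log (val (prime_natCast_of_inert q hq3)
        ((s : K3) * zeta ^ i * (zeta - 1) ^ j * 2 ^ k * (p : K3) ^ l * (q : K3) ^ m * w ^ 3)) =
      -m + 3 * log (val (prime_natCast_of_inert q hq3) w) := by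
  have h2' : ¬ q ∣ 2 := fun h => hq2 ((Nat.prime_dvd_prime_iff_eq hqp.out Nat.prime_two).mp h)
  have hp' : ¬ q ∣ p := fun h => hpq ((Nat.prime_dvd_prime_iff_eq hqp.out hpp.out).mp h).symm
  rw [log_val_normalForm_twoInert hs i j k l m hw (prime_natCast_of_inert q hq3), log_val_zeta_sub_one,
    show (2 : K3) = ((2 : ℕ) : K3) by norm_num, log_val_natCast_of_not_dvd _ h2', log_val_natCast_of_not_dvd _ hp',
    log_val_natCast_self]
  ring

include hp3 hq3 in
/-- `3 ∣ log vL ⟹ j = 0` (`j < 3`). [cite: SilvermanAEC2009, Prop. X.4.9] -/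
theorem j_eq_zero_of_dvd_twoInert (hj : j < 3)
    (h : (3 : ℤ) ∣ log (vL ((s : K3) * zeta ^ i * (zeta - 1) ^ j * 2 ^ k * (p : K3) ^ l * (q : K3) ^ m * w ^ 3))) :
    j = 0 := by
  rw [log_vL_normalForm_twoInert hp3 hq3 hs i j k l m hw] at h; omega

include hp2 hq2 in
/-- `3 ∣ log val₂ ⟹ k = 0` (`k < 3`). [cite: SilvermanAEC2009, Prop. X.4.9] -/
theorem k_eq_zero_of_dvd_twoInert (hk : k < 3)
    (h : (3 : ℤ) ∣ log (val prime_natCast_two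
      ((s : K3) * zeta ^ i * (zeta - 1) ^ j * 2 ^ k * (p : K3) ^ l * (q : K3) ^ m * w ^ 3))) : k = 0 := by
  rw [log_val2_normalForm_twoInert hp2 hq2 hs i j k l m hw] at h; omega

include hp3 hp2 hpq in
/-- `3 ∣ log val_p ⟹ l = 0` (`l < 3`). [cite: SilvermanAEC2009, Prop. X.4.9] -/
theorem l_eq_zero_of_dvd_twoInert (hl : l < 3)
    (h : (3 : ℤ) ∣ log (val (prime_natCast_of_inert p hp3)
      ((s : K3) * zeta ^ i * (zeta - 1) ^ j * 2 ^ k * (p : K3) ^ l * (q : K3) ^ m * w ^ 3))) : l = 0 := by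
  rw [log_valp_normalForm_twoInert hp3 hp2 hpq hs i j k l m hw] at h; omega

include hq3 hq2 hpq in
/-- `3 ∣ log val_q ⟹ m = 0` (`m < 3`). [cite: SilvermanAEC2009, Prop. X.4.9] -/
theorem m_eq_zero_of_dvd_twoInert (hm : m < 3)
    (h : (3 : ℤ) ∣ log (val (prime_natCast_of_inert q hq3)
      ((s : K3) * zeta ^ i * (zeta - 1) ^ j * 2 ^ k * (p : K3) ^ l * (q : K3) ^ m * w ^ 3))) : m = 0 := by
  rw [log_valq_normalForm_twoInert hq3 hq2 hpq hs i j k l m hw] at h; omega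

end Valuations

/-! ### The residue character at `2` of a normal form with `j = 0` -/

section Characters

variable {s : ℤ} (hs : s = 1 ∨ s = -1) (i k l m : ℕ) {w : K3} (hw : w ≠ 0)
include hs hw

/-- **`χ₂` of a normal form** (`j = 0`): `χ₂ = i` (`χ₂(ζ) = 1`, `χ₂(ℚˣ) = 0`, `χ₂(w³) = 0`).
[cite: IrelandRosen1990, Ch. 9 §3] -/
theorem chi2_normalForm_twoInert : chi2 ((s : K3) * zeta ^ i * 2 ^ k * (p : K3) ^ l * (q : K3) ^ m * w ^ 3) = i := by
  have hs0 : (s : K3) ≠ 0 := by rcases hs with rfl | rfl <;> norm_num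
  have hz : (zeta : K3) ≠ 0 := isPrimitiveRoot_zeta.ne_zero (by norm_num)
  have hp0 : (p : K3) ≠ 0 := natCast_ne_zero (p := p)
  have hq0 : (q : K3) ≠ 0 := natCast_ne_zero (p := q)
  have H := cubicChar_mul_two
  have R := cubicChar_ratCast_two
  have h1 : (s : K3) * zeta ^ i ≠ 0 := mul_ne_zero hs0 (pow_ne_zero _ hz)
  have h3 : (s : K3) * zeta ^ i * 2 ^ k ≠ 0 := mul_ne_zero h1 (pow_ne_zero _ two_ne_zero)
  have h4 : (s : K3) * zeta ^ i * 2 ^ k * (p : K3) ^ l ≠ 0 := mul_ne_zero h3 (pow_ne_zero _ hp0)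
  have h5 : (s : K3) * zeta ^ i * 2 ^ k * (p : K3) ^ l * (q : K3) ^ m ≠ 0 := mul_ne_zero h4 (pow_ne_zero _ hq0)
  rw [chi2, chi_mul _ H h5 (pow_ne_zero _ hw), chi_mul _ H h4 (pow_ne_zero _ hq0),
    chi_mul _ H h3 (pow_ne_zero _ hp0), chi_mul _ H h1 (pow_ne_zero _ two_ne_zero),
    chi_mul _ H hs0 (pow_ne_zero _ hz), chi_intCast _ R, chi_pow _ H hz, chi_pow_three _ H hw,
    show (2 : K3) = ((2 : ℕ) : K3) by norm_num, chi_pow _ H (by norm_num), chi_natCast _ R,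
    chi_pow _ H hp0, chi_natCast _ R, chi_pow _ H hq0, chi_natCast _ R, ← chi2, chi2_zeta]
  ring

end Characters

/-! ### Classes modulo cubes -/

/-- **The class of a normal form**: `[s ζ^i λ^j 2^k p^l q^m w³] = [ζ^i λ^j 2^k p^l q^m]`.
[cite: SilvermanAEC2009, Prop. X.4.9] -/
theorem cubeClass_normalForm_twoInert {s : ℤ} (hs : s = 1 ∨ s = -1) (i j k l m : ℕ) {w : K3} (hw : w ≠ 0) :
    cubeClass ((s : K3) * zeta ^ i * (zeta - 1) ^ j * 2 ^ k * (p : K3) ^ l * (q : K3) ^ m * w ^ 3) =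
      cubeClass (zeta ^ i * (zeta - 1) ^ j * 2 ^ k * (p : K3) ^ l * (q : K3) ^ m : K3) := by
  have hz : (zeta : K3) ≠ 0 := isPrimitiveRoot_zeta.ne_zero (by norm_num)
  have hm : (zeta ^ i * (zeta - 1) ^ j * 2 ^ k * (p : K3) ^ l * (q : K3) ^ m : K3) ≠ 0 :=
    mul_ne_zero (mul_ne_zero (mul_ne_zero (mul_ne_zero (pow_ne_zero _ hz)
      (pow_ne_zero _ zeta_sub_one_ne_zero)) (pow_ne_zero _ two_ne_zero)) (pow_ne_zero _ (natCast_ne_zero (p := p))))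
      (pow_ne_zero _ (natCast_ne_zero (p := q)))
  rw [show (s : K3) * zeta ^ i * (zeta - 1) ^ j * 2 ^ k * (p : K3) ^ l * (q : K3) ^ m * w ^ 3 =
      (s * (zeta ^ i * (zeta - 1) ^ j * 2 ^ k * (p : K3) ^ l * (q : K3) ^ m)) * w ^ 3 by ring,
    cubeClass_mul_pow_three (mul_ne_zero (by rcases hs with rfl | rfl <;> norm_num) hm) hw]
  rcases hs with rfl | rfl
  · rw [Int.cast_one, one_mul]
  · rw [Int.cast_neg, Int.cast_one, neg_one_mul, cubeClass_neg]

/-- **The `27` classes of the `√−3`-Selmer box for `y² = x³ + (pq)²`**: a normal form with `i = j = 0` has class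
`[2^k p^l q^m]`, the class of the RATIONAL number `2^k p^l q^m`. [cite: Jeong2019RankExactlyTwoII, Lemma 3.3] -/
theorem cubeClass_normalForm_twoInert_of_i_j_eq_zero {s : ℤ} (hs : s = 1 ∨ s = -1) (k l m : ℕ) {w : K3}
    (hw : w ≠ 0) :
    cubeClass ((s : K3) * zeta ^ 0 * (zeta - 1) ^ 0 * 2 ^ k * (p : K3) ^ l * (q : K3) ^ m * w ^ 3) =
      cubeClass (((2 ^ k * p ^ l * q ^ m : ℚ)) : K3) := by
  rw [cubeClass_normalForm_twoInert hs 0 0 k l m hw, pow_zero, pow_zero, one_mul, one_mul]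
  congr 1
  push_cast
  ring

end TwoInert

end K3

end Literature.NumberTheory.NumberFields
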